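import Summits.BirchSwinnertonDyer.BirchSwinnertonDyer.Theorems.ResidualThetaTransportAtTwoPlusDualLayerToolkit
import HarnessLib

/-!
# θ-ALGEBRA (Weierstrass induction) for the ISO θ-plan: a compatible family `θ_n ∈ Λ/(ω_n, p^J)` killed at unboundedly many
# layers by distinguished polynomials `F_k` with `p^{n_k} − deg F_k → ∞` is ZERO at every layer

Routes `ResidualThetaTransportAtTwo` (RTT, crux r201 `ResidualLambdaFormulaNegDiscAtTwo`, stmt-BirchSwinnertonDyer-23110) /
`ThetaPartnerAtTwo`. Seat `prover-bsd-wall-tp2-p2x-w3` g13; `--supports stmt-BirchSwinnertonDyer-23110` (the «θ-algebra» brick of the ISO /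
H-PLUSDUAL plan of w2 g15/g16 and lead g12: «(θ_n ∈ Λ/(2^J,ω_n))_n compatible under projection, θ_n·ω̃∓_n·(ω̃∓_n)^ι = 0 ∀ n ≥ n₀ of one
parity ⟹ θ_n = 0 ∀ n», bus 21:43Z). THEOREMS ONLY (no definition, no named fact, no instance, no `sorry`); PURE ALGEBRA in
`Λ = ℤ_p⟦T⟧`; closes nothing.

STATEMENT (lift-friendly: elements of `Λ`, membership in the ideals `I(n, J) = (ω_n) + (p^J)`, `ω_n = (T+1)^{pⁿ} − 1`; no quotient
types, no inverse limits): **`forall_mem_omegaIdeal_of_compatible`** — for `θ : ℕ → Λ` with `θ m − θ n ∈ I(n, J)` (`n ≤ m`), levels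
`n_k` and DISTINGUISHED `F_k ∈ ℤ_p[T]` with `∀ N ∃ k, N + deg F_k ≤ p^{n_k}`, and `θ(n_k)·F_k ∈ I(n_k, J)` for all `k`: `θ n ∈ I(n, J)`
for every `n`. In the θ-plan, `θ_n` encodes the layer pairing on the cofree layer `S[2^J, ω_n] ≅ (ℤ/2^J)[T]/(ω_n)` ((R1)@2 +
`…PlusDualLayerNorms`) and `F_k = ω̃⁻_{2k}·(ω̃⁻_{2k})^ι ~ (ω̃⁻_{2k})²` (honest plus classes `= ω̃⁻·S` are isotropic); the gap at `p = 2` is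
`4^k − 2(4^k−1)/3 → ∞`.

PROOF (B. D. Kim's «both are divisible» replaced by a Weierstrass induction on `J`, as proposed by w2 g15): modulo `p`, `Λ/p = 𝔽_p⟦T⟧`
is a domain in which `F_k ≡ T^{deg F_k}` and `ω_n ≡ T^{pⁿ}` (distinguished), so `T^{p^{n_k} − deg F_k} ∣ θ̄(n_k)`, whence by the gap
and compatibility `θ n ∈ (ω_n) + (p)` for EVERY `n`; writing `θ n = ω_n a_n + p·θ′ n`, the cancellation «`ω_n α ∈ pΛ ⟹ α ∈ pΛ`» makes
`θ′` a compatible family modulo `I(·, J−1)` satisfying the same hypothesis; induct.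
* §1 residue calculus: `map_residue_eq_zero_iff_C_dvd` (`f ↦ f mod p` has kernel `pΛ`), `map_residue_coe_eq_X_pow` (distinguished
  `D ↦ T^{deg D}`), `C_dvd_of_coe_mul_dvd` (`D·α ∈ pΛ ⟹ α ∈ pΛ`), `X_pow_sub_omega_dvd` (`T^{pⁿ} − ω_n ∈ pΛ`),
  `exists_eq_X_pow_mul_add_of_mul_coe_mem` (`θ·D ∈ (ω_n) + (p)`, `deg D ≤ pⁿ` ⟹ `θ ∈ (T^{pⁿ − deg D}) + (p)`).
* §2 the induction: `forall_mem_omegaIdeal_of_compatible`.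

HONEST FRAMING: closes nothing; ISO / `hdual_Alt` / 23110 NOT proved; BSD is not proved by any of this.
References: [BDKim2007] B. D. Kim, Compositio Math. 143 (2007), Prop. 3.15 (proof, pp. 56–57); [Washington1997] §7.1 (distinguished
polynomials, Weierstrass preparation), §13.2; [Lang1990] Ch. 5 §1–2.
-/

set_option autoImplicit false
-- D-0017: single-problem summit, so `Summit.BirchSwinnertonDyer.BirchSwinnertonDyer.…` repeats a namespace BY DESIGN.
set_option linter.dupNamespace false

noncomputable section

open scoped Classical
open Polynomial Literature.NumberTheory.EllipticCurves

namespace Summit.BirchSwinnertonDyer.BirchSwinnertonDyer.Theorems.ResidualThetaLayer.PlusDual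

/-! ## §1 Residue calculus in `Λ = ℤ_p⟦T⟧` -/

section Residue

variable (p : ℕ) [hp : Fact p.Prime]

/-- **`f mod p = 0 ↔ p ∣ f`**: the kernel of `Λ → 𝔽_p⟦T⟧` (coefficientwise reduction modulo `𝔪 = (p)`) is `pΛ`.
[cite: Washington1997, §7.1] -/
theorem map_residue_eq_zero_iff_C_dvd (f : PowerSeries ℤ_[p]) :
    PowerSeries.map (Ideal.Quotient.mk (IsLocalRing.maximalIdeal ℤ_[p])) f = 0 ↔ PowerSeries.C (p : ℤ_[p]) ∣ f := by
  rw [PowerSeries.C_dvd_iff_forall_dvd_coeff, PowerSeries.ext_iff]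
  refine forall_congr' fun n ↦ ?_
  rw [PowerSeries.coeff_map, map_zero, Ideal.Quotient.eq_zero_iff_mem, PadicInt.maximalIdeal_eq_span_p, Ideal.mem_span_singleton]

/-- **A distinguished `D` reduces to `T^{deg D}` modulo `p`** (as a power series). [cite: Washington1997, §7.1] -/
theorem map_residue_coe_eq_X_pow {D : ℤ_[p][X]} (hD : D.IsDistinguishedAt (IsLocalRing.maximalIdeal ℤ_[p])) :
    PowerSeries.map (Ideal.Quotient.mk (IsLocalRing.maximalIdeal ℤ_[p])) (D : PowerSeries ℤ_[p]) =
      (PowerSeries.X : PowerSeries (ℤ_[p] ⧸ IsLocalRing.maximalIdeal ℤ_[p])) ^ D.natDegree := by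
  rw [← Polynomial.polynomial_map_coe, hD.map_eq_X_pow, Polynomial.coe_pow, Polynomial.coe_X]

/-- **Cancellation modulo `p` by a distinguished polynomial: `D·α ∈ pΛ ⟹ α ∈ pΛ`** (`𝔽_p⟦T⟧` is a domain and `D ≡ T^{deg D} ≠ 0`).
(Kim/w2: «`ω_n α ∈ 2Λ ⇒ α ∈ 2Λ` by Weierstrass division».) [cite: Washington1997, §7.1 (Prop. 7.2)] -/
theorem C_dvd_of_coe_mul_dvd {D : ℤ_[p][X]} (hD : D.IsDistinguishedAt (IsLocalRing.maximalIdeal ℤ_[p])) {α : PowerSeries ℤ_[p]}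
    (h : PowerSeries.C (p : ℤ_[p]) ∣ (D : PowerSeries ℤ_[p]) * α) : PowerSeries.C (p : ℤ_[p]) ∣ α := by
  rw [← map_residue_eq_zero_iff_C_dvd] at h ⊢
  rw [map_mul, map_residue_coe_eq_X_pow p hD] at h
  exact (mul_eq_zero.mp h).resolve_left (pow_ne_zero _ PowerSeries.X_ne_zero)

/-- **`T^{pⁿ} − ω_n ∈ pΛ`** (`ω_n = (T+1)^{pⁿ} − 1` is distinguished of degree `pⁿ`, so both reduce to `T^{pⁿ}` modulo `p`).
[cite: Washington1997, §7.1] -/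
theorem C_dvd_X_pow_sub_omega (n : ℕ) :
    PowerSeries.C (p : ℤ_[p]) ∣ (PowerSeries.X : PowerSeries ℤ_[p]) ^ p ^ n -
      (((X + 1 : ℤ_[p][X]) ^ p ^ n - 1 : ℤ_[p][X]) : PowerSeries ℤ_[p]) := by
  rw [← map_residue_eq_zero_iff_C_dvd, map_sub, map_residue_coe_eq_X_pow p (Kato2004.IwasawaH1Exists.isDistinguishedAt_omega p n),
    UniversalToricDescentTorsionFreeByCount.natDegree_omega p, map_pow, PowerSeries.map_X, sub_self]

/-- **Mod-`p` divisibility extraction**: if `θ·D = X^N·a + p·b` with `D` distinguished of degree `≤ N`, then `θ = X^{N − deg D}·c + p·d`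
(reduce modulo `p` and cancel `T^{deg D}` in the domain `𝔽_p⟦T⟧`). [cite: Washington1997, §7.1] -/
theorem exists_eq_X_pow_mul_add_of_mul_coe_eq {D : ℤ_[p][X]} (hD : D.IsDistinguishedAt (IsLocalRing.maximalIdeal ℤ_[p])) {N : ℕ}
    (hN : D.natDegree ≤ N) {θ a b : PowerSeries ℤ_[p]}
    (h : θ * (D : PowerSeries ℤ_[p]) = (PowerSeries.X : PowerSeries ℤ_[p]) ^ N * a + PowerSeries.C (p : ℤ_[p]) * b) :
    ∃ c d : PowerSeries ℤ_[p], θ = (PowerSeries.X : PowerSeries ℤ_[p]) ^ (N - D.natDegree) * c + PowerSeries.C (p : ℤ_[p]) * d := by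
  set red := PowerSeries.map (Ideal.Quotient.mk (IsLocalRing.maximalIdeal ℤ_[p])) with hred
  -- modulo `p`: `θ̄·T^{deg D} = T^N ā = T^{deg D}·(T^{N − deg D} ā)`
  have h1 : red θ * PowerSeries.X ^ D.natDegree = (PowerSeries.X ^ (N - D.natDegree) * red a) * PowerSeries.X ^ D.natDegree := by
    have := congrArg red h
    rw [map_mul, map_residue_coe_eq_X_pow p hD, map_add, map_mul, map_mul, map_pow, PowerSeries.map_X, PowerSeries.map_C,
      Ideal.Quotient.eq_zero_iff_mem.mpr (by rw [PadicInt.maximalIdeal_eq_span_p]; exact Ideal.mem_span_singleton_self _),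
      map_zero, zero_mul, add_zero] at this
    rw [this, mul_right_comm, ← pow_add, Nat.sub_add_cancel hN]
  have h2 : red θ = PowerSeries.X ^ (N - D.natDegree) * red a :=
    mul_right_cancel₀ (pow_ne_zero _ PowerSeries.X_ne_zero) h1
  have h3 : red (θ - PowerSeries.X ^ (N - D.natDegree) * a) = 0 := by
    rw [map_sub, map_mul, map_pow, PowerSeries.map_X, h2, sub_self]
  rw [hred, map_residue_eq_zero_iff_C_dvd] at h3
  obtain ⟨d, hd⟩ := h3
  exact ⟨a, d, by rw [← hd]; ring⟩

/-- Membership in a two-generator ideal `(a) + (b)` (bookkeeping). [folklore] -/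
theorem mem_span_sup_span_iff {R : Type*} [CommRing R] {a b x : R} :
    x ∈ Ideal.span {a} ⊔ Ideal.span {b} ↔ ∃ u v : R, x = a * u + b * v := by
  rw [← Ideal.span_insert, Ideal.mem_span_pair]
  constructor
  · rintro ⟨u, v, h⟩; exact ⟨u, v, by rw [← h]; ring⟩
  · rintro ⟨u, v, h⟩; exact ⟨u, v, by rw [h]; ring⟩

end Residue

/-! ## §2 The Weierstrass induction -/

section Theta

variable (p : ℕ) [hp : Fact p.Prime]

/-- **θ-ALGEBRA.** Let `θ : ℕ → Λ` be a family of lifts compatible modulo the ideals `I(n, J) = (ω_n) + (p^J)` (`θ m − θ n ∈ I(n, J)`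
for `n ≤ m`), and suppose that at levels `n_k` it is killed by DISTINGUISHED polynomials `F_k` modulo `I(n_k, J)` —
`θ(n_k)·F_k ∈ I(n_k, J)` — whose degrees leave an unbounded gap: `∀ N ∃ k, N + deg F_k ≤ p^{n_k}`. Then `θ n ∈ I(n, J)` for EVERY `n`.
(Induction on `J`: modulo `p` everything lives in the domain `𝔽_p⟦T⟧` where `F_k ≡ T^{deg F_k}`, `ω_n ≡ T^{pⁿ}`, giving `θ n ∈ (ω_n) + (p)`
for all `n` by the gap and compatibility; then `θ n = ω_n a_n + p θ′ n` with `θ′` compatible modulo `I(·, J−1)` and killed by the same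
`F_k`, by the cancellation «`ω_n α ∈ pΛ ⟹ α ∈ pΛ`».) In the ISO θ-plan `θ_n` encodes the layer pairing on `S[2^J, ω_n] ≅ (ℤ/2^J)[T]/(ω_n)` and
`F_k ~ (ω̃⁻_{2k})²`. [cite: BDKim2007, Prop. 3.15 (proof, pp. 56–57)] [cite: Washington1997, §7.1 and §13.2] -/
theorem forall_mem_omegaIdeal_of_compatible (J : ℕ) (θ : ℕ → PowerSeries ℤ_[p])
    (hcompat : ∀ n m : ℕ, n ≤ m → θ m - θ n ∈
      Ideal.span {(((X + 1 : ℤ_[p][X]) ^ p ^ n - 1 : ℤ_[p][X]) : PowerSeries ℤ_[p])} ⊔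
        Ideal.span {PowerSeries.C ((p : ℤ_[p]) ^ J)})
    (nk : ℕ → ℕ) (F : ℕ → ℤ_[p][X]) (hF : ∀ k, (F k).IsDistinguishedAt (IsLocalRing.maximalIdeal ℤ_[p]))
    (hgap : ∀ N : ℕ, ∃ k, N + (F k).natDegree ≤ p ^ nk k)
    (hyp : ∀ k, θ (nk k) * (F k : PowerSeries ℤ_[p]) ∈
      Ideal.span {(((X + 1 : ℤ_[p][X]) ^ p ^ nk k - 1 : ℤ_[p][X]) : PowerSeries ℤ_[p])} ⊔
        Ideal.span {PowerSeries.C ((p : ℤ_[p]) ^ J)}) :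
    ∀ n : ℕ, θ n ∈ Ideal.span {(((X + 1 : ℤ_[p][X]) ^ p ^ n - 1 : ℤ_[p][X]) : PowerSeries ℤ_[p])} ⊔
      Ideal.span {PowerSeries.C ((p : ℤ_[p]) ^ J)} := by
  -- notation-free abbreviations
  have hCp : (PowerSeries.C (p : ℤ_[p]) : PowerSeries ℤ_[p]) ≠ 0 := by
    intro h
    have := congrArg PowerSeries.constantCoeff h
    rw [PowerSeries.constantCoeff_C, map_zero] at this
    exact (Nat.cast_ne_zero.mpr hp.out.ne_zero) this
  have hω : ∀ n, (((X + 1 : ℤ_[p][X]) ^ p ^ n - 1 : ℤ_[p][X])).IsDistinguishedAt (IsLocalRing.maximalIdeal ℤ_[p]) :=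
    Kato2004.IwasawaH1Exists.isDistinguishedAt_omega p
  -- `ω_m = ω_n · ν` for `n ≤ m`
  have hdiv : ∀ {n m : ℕ}, n ≤ m → ∃ ν : PowerSeries ℤ_[p],
      (((X + 1 : ℤ_[p][X]) ^ p ^ m - 1 : ℤ_[p][X]) : PowerSeries ℤ_[p]) =
        (((X + 1 : ℤ_[p][X]) ^ p ^ n - 1 : ℤ_[p][X]) : PowerSeries ℤ_[p]) * ν := by
    intro n m hnm
    refine ⟨((∑ i ∈ Finset.range (p ^ (m - n)), ((X + 1 : ℤ_[p][X]) ^ p ^ n) ^ i : ℤ_[p][X]) : PowerSeries ℤ_[p]), ?_⟩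
    rw [← Polynomial.coe_mul, ← omega_eq_omega_mul_geom_sum (p := p) hnm]
  induction J generalizing θ with
  | zero =>
    intro n
    have htop : Ideal.span {PowerSeries.C ((p : ℤ_[p]) ^ 0)} = ⊤ := by
      rw [pow_zero, map_one, Ideal.span_singleton_one]
    rw [htop, sup_top_eq]; trivial
  | succ J ih =>
    have hCsucc : PowerSeries.C ((p : ℤ_[p]) ^ (J + 1)) = PowerSeries.C (p : ℤ_[p]) * PowerSeries.C ((p : ℤ_[p]) ^ J) := by
      rw [pow_succ', map_mul]
    -- Step (a): `θ n ∈ (ω_n) + (p)` for every `n`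
    have step_a : ∀ n, ∃ a t : PowerSeries ℤ_[p],
        θ n = (((X + 1 : ℤ_[p][X]) ^ p ^ n - 1 : ℤ_[p][X]) : PowerSeries ℤ_[p]) * a + PowerSeries.C (p : ℤ_[p]) * t := by
      intro n
      obtain ⟨k, hk⟩ := hgap (p ^ n)
      have hnk : n ≤ nk k := by
        by_contra hlt
        have := pow_lt_pow_right₀ (by exact_mod_cast hp.out.one_lt : (1 : ℕ) < p) (not_le.mp hlt)
        omega
      obtain ⟨u, v, huv⟩ := mem_span_sup_span_iff.mp (hyp k)
      obtain ⟨w, hw⟩ := C_dvd_X_pow_sub_omega p (nk k)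
      have hωk : (((X + 1 : ℤ_[p][X]) ^ p ^ nk k - 1 : ℤ_[p][X]) : PowerSeries ℤ_[p]) =
          (PowerSeries.X : PowerSeries ℤ_[p]) ^ p ^ nk k - PowerSeries.C (p : ℤ_[p]) * w := by
        rw [← hw, sub_sub_cancel]
      -- `θ(n_k)·F_k = T^{p^{n_k}} u + p (p^J v − w u)`
      have h1 : θ (nk k) * (F k : PowerSeries ℤ_[p]) =
          (PowerSeries.X : PowerSeries ℤ_[p]) ^ p ^ nk k * u +
            PowerSeries.C (p : ℤ_[p]) * (PowerSeries.C ((p : ℤ_[p]) ^ J) * v - w * u) := by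
        rw [huv, hCsucc, hωk]; ring
      obtain ⟨c, d, hcd⟩ := exists_eq_X_pow_mul_add_of_mul_coe_eq p (hF k) (by omega) h1
      -- `T^{p^{n_k} − deg F_k} = T^{pⁿ} · T^{…}`, `T^{pⁿ} = ω_n + p w'`
      obtain ⟨w', hw'⟩ := C_dvd_X_pow_sub_omega p n
      have hXn : (PowerSeries.X : PowerSeries ℤ_[p]) ^ p ^ n =
          (((X + 1 : ℤ_[p][X]) ^ p ^ n - 1 : ℤ_[p][X]) : PowerSeries ℤ_[p]) + PowerSeries.C (p : ℤ_[p]) * w' := by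
        rw [← hw', add_sub_cancel]
      obtain ⟨u', v', huv'⟩ := mem_span_sup_span_iff.mp (hcompat n (nk k) hnk)
      have e1 : (PowerSeries.X : PowerSeries ℤ_[p]) ^ (p ^ nk k - (F k).natDegree) =
          (PowerSeries.X : PowerSeries ℤ_[p]) ^ p ^ n * PowerSeries.X ^ (p ^ nk k - (F k).natDegree - p ^ n) := by
        rw [← pow_add]; congr 1; omega
      refine ⟨PowerSeries.X ^ (p ^ nk k - (F k).natDegree - p ^ n) * c - u',
        w' * PowerSeries.X ^ (p ^ nk k - (F k).natDegree - p ^ n) * c + d - PowerSeries.C ((p : ℤ_[p]) ^ J) * v', ?_⟩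
      have e2 : θ n = θ (nk k) - (θ (nk k) - θ n) := by ring
      rw [e2, huv', hcd, e1, hXn, hCsucc]; ring
    choose a t hat using step_a
    -- Step (b): `t` is compatible modulo `I(·, J)`
    have hcompat' : ∀ n m : ℕ, n ≤ m → t m - t n ∈
        Ideal.span {(((X + 1 : ℤ_[p][X]) ^ p ^ n - 1 : ℤ_[p][X]) : PowerSeries ℤ_[p])} ⊔
          Ideal.span {PowerSeries.C ((p : ℤ_[p]) ^ J)} := by
      intro n m hnm
      obtain ⟨u, v, huv⟩ := mem_span_sup_span_iff.mp (hcompat n m hnm)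
      obtain ⟨ν, hν⟩ := hdiv hnm
      rw [hat m, hat n, hν, hCsucc] at huv
      -- `p·(t m − t n − p^J v) = ω_n·(u + a n − ν a m)`
      have h2 : PowerSeries.C (p : ℤ_[p]) * (t m - t n - PowerSeries.C ((p : ℤ_[p]) ^ J) * v) =
          (((X + 1 : ℤ_[p][X]) ^ p ^ n - 1 : ℤ_[p][X]) : PowerSeries ℤ_[p]) * (u + a n - ν * a m) := by
        linear_combination huv
      obtain ⟨e, he⟩ := C_dvd_of_coe_mul_dvd p (hω n) ⟨_, h2.symm⟩
      rw [he, mul_left_comm] at h2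
      have h3 := mul_left_cancel₀ hCp h2
      exact mem_span_sup_span_iff.mpr ⟨e, v, by linear_combination h3⟩
    -- Step (c): the hypothesis for `t` at level `J`
    have hyp' : ∀ k, t (nk k) * (F k : PowerSeries ℤ_[p]) ∈
        Ideal.span {(((X + 1 : ℤ_[p][X]) ^ p ^ nk k - 1 : ℤ_[p][X]) : PowerSeries ℤ_[p])} ⊔
          Ideal.span {PowerSeries.C ((p : ℤ_[p]) ^ J)} := by
      intro k
      obtain ⟨u, v, huv⟩ := mem_span_sup_span_iff.mp (hyp k)
      rw [hat (nk k), hCsucc] at huv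
      have h2 : PowerSeries.C (p : ℤ_[p]) * (t (nk k) * (F k : PowerSeries ℤ_[p]) - PowerSeries.C ((p : ℤ_[p]) ^ J) * v) =
          (((X + 1 : ℤ_[p][X]) ^ p ^ nk k - 1 : ℤ_[p][X]) : PowerSeries ℤ_[p]) * (u - a (nk k) * (F k : PowerSeries ℤ_[p])) := by
        linear_combination huv
      obtain ⟨e, he⟩ := C_dvd_of_coe_mul_dvd p (hω (nk k)) ⟨_, h2.symm⟩
      rw [he, mul_left_comm] at h2
      have h3 := mul_left_cancel₀ hCp h2
      exact mem_span_sup_span_iff.mpr ⟨e, v, by linear_combination h3⟩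
    -- induction hypothesis and reassembly
    have ht := ih t hcompat' hyp'
    intro n
    obtain ⟨e, v, hev⟩ := mem_span_sup_span_iff.mp (ht n)
    refine mem_span_sup_span_iff.mpr ⟨a n + PowerSeries.C (p : ℤ_[p]) * e, v, ?_⟩
    rw [hat n, hev, hCsucc]; ring

end Theta

end Summit.BirchSwinnertonDyer.BirchSwinnertonDyer.Theorems.ResidualThetaLayer.PlusDual

end
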